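import Literature.AlgebraicGeometry.Motives.HodgeStructureLefschetzGroupPoints
import Literature.AlgebraicGeometry.Motives.HodgeStructureCentralizerDirectSum
import HarnessLib

/-!
# Milne's Propositions 1.1 and 1.5 for a FINITE FAMILY: `C(⊕_j H_j) ⊆ ∏_j C(H_j)` (block diagonal) with equality iff
# `Hom(H_i, H_j) = 0` for `i ≠ j`, `∏_j C(H_j) ≃ₐ C(⊕_j H_j)` and `∏_j S(H_j)(ℚ) ≃* S(⊕_j H_j)(ℚ)` in that case, the product
# involution, and the powers `C(H^{⊕ι}) = Δ C(H)`, `S(H^{⊕ι})(ℚ) = Δ S(H)(ℚ)` — on the `HodgeStructure.pi` carrier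
# (Milne 1999 §1 p. 643: "Let `A = A₁ × ⋯ × A_s`. Then `C(A) ⊂ C(A₁) × ⋯ × C(A_s)`, with equality holding if and only if
# `Hom(A_i, A_j) = 0`"; "the diagonal action of `C(A)` on `rV(A)` identifies `C(A)` with `C(A^r)`"; Propositions 1.1, 1.5)

[topic AlgebraicGeometry/Motives]

Layer `Literature/AlgebraicGeometry/Motives`, lane `lit-hodgefound` (Track 2 foundations library; seat `lit-hodgefound-p34`,
generation 21, self-proposed row g21-#2 of `run/shared/lean/pub/lit-hodgefound/SKELETON.md`). The `s`-summand / `r`-fold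
form of the seat's binary files g18-#3 `Motives/HodgeStructureCentralizerDirectSum` (`C(H₁ ⊕ H₂)`, `C(H ⊕ H)`) and g18-#4
`Motives/HodgeStructureLefschetzGroupDirectSum` (`S(H₁ ⊕ H₂)(ℚ)`, `S(H ⊕ H)(ℚ)`), whose docstrings left "`s > 2` summands and
`r > 2`" to "the `pi`-carrier version"; written on the tree's finite direct sum `HodgeStructure.pi H` of a family
`H : ∀ j : ι, HodgeStructure (W j) n` (`Motives/HodgeStructureDirectSum`, with `Polarization.pi`, `Hom.piSingle`, `Hom.piProj`)
after the pattern of the Mumford–Tate twin `Motives/MumfordTateGroupDirectSumFamily` (`piBlock`, `LinearEquiv.piCongrRight`;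
seat p02). THEOREMS plus seven definitions WITH BODIES (`piDiag` = `diag(f_j)`, `piDiagAlgHom`, `centralizerPiAlgEquiv`,
`centralizerPiConstAlgEquiv`, `Polarization.lefschetzGroupPiBlock`, `Polarization.lefschetzGroupPiMulEquiv`,
`Polarization.lefschetzGroupPiConstMulEquiv`); no named fact (net debt `0`).

## The source, verbatim

J. S. Milne, *Lefschetz classes on abelian varieties*, Duke Math. J. **96** (1999) 639–675 [Milne1999LefschetzClasses]
(held `paper:doi-10-1215-s0012-7094-99-09620-5`, p0005 = p. 643, p0006 = p. 644):
* p. 643 L12–L24: "For any positive integer `r`, `V(A^r) = rV(A)`, and the diagonal action of `C(A)` on `rV(A)` identifies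
  `C(A)` with `C(A^r)` (as `k`-algebras with involution). Let `A = A₁ × ⋯ × A_s`. Then `C(A) ⊂ C(A₁) × ⋯ × C(A_s)`, **with
  equality holding if and only if `Hom(A_i, A_j) = 0` for all `i, j`, `i ≠ j`**. Moreover, if `D_i` is an ample divisor on
  `A_i`, […] `D = Σ_i A₁ × ⋯ × A_{i-1} × D_i × A_{i+1} × ⋯ × A_s` is an ample divisor on `A`, and the involution it defines on
  `C(A)` is the restriction of the product of the involutions on the `C(A_i)` defined by the `D_i`."
* **Proposition 1.1** (p. 643 L27–L31): "Let `A₁, …, A_s` be a set of representatives for the simple isogeny factors of `A`,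
  so that there exists an isogeny `A₁^{r₁} × ⋯ × A_s^{r_s} → A` for some `r_i > 0`. Any such isogeny induces an isomorphism
  `C(A₁) × ⋯ × C(A_s) → C(A)` of `k`-algebras with involution, which is independent of the choice of the isogeny."
* p. 644 L18: "`S(A)(R) = {γ ∈ C(A) ⊗_k R | γ†γ = 1}`." **Proposition 1.5** (p. 644 L24–L29): "Let `A₁, …, A_s` be a set of
  representatives for the simple isogeny factors of `A` […] Any such isogeny induces an isomorphism
  `S(A₁) × ⋯ × S(A_s) → S(A)`, which is independent of the choice of the isogeny. Proof. This is an immediate consequence of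
  Proposition 1.1."

On the abstract `ℚ`-Hodge structure "simple and pairwise non-isogenous" is the hypothesis `h0 : Hom(H_j, H_i) = 0` for
`i ≠ j`; `C(X) = Subalgebra.centralizer ℚ End_HS(X)` (g18-#1), `S(X)(ℚ) = Polarization.lefschetzGroup` (g18-#1);
`End_HS(⊕_j H_j)` has the blocks `pr_i a in_j ∈ Hom(H_j, H_i)` (§0).

## What is PROVED (all on `ℚ`-points)

* §0 `piDiag f = diag(f_j)` and its algebra (`piDiag_apply`, `proj_comp_piDiag_comp_single`, `piDiag_comp_single`,
  `proj_comp_piDiag`, `piDiag_mul/one/injective`, `piDiagAlgHom`, `coe_piCongrRight_eq_piDiag`); the blocks of `End_HS(⊕ H)`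
  (`single_comp_hom_comp_proj_mem_endAlg_pi`, `single_comp_proj_mem_endAlg_pi`, `single_comp_comp_proj_mem_endAlg_pi`,
  `exists_hom_toLinearMap_eq_block`).
* §1 **"`C(A) ⊂ C(A₁) × ⋯ × C(A_s)`"**: `apply_single_apply_of_ne_of_mem_centralizer_endAlg_pi` (off-diagonal blocks vanish),
  **`eq_piDiag_of_mem_centralizer_endAlg_pi`** (`c = diag(pr_j c in_j)`), `block_comp_hom_eq_hom_comp_block_…` (the blocks
  intertwine every `φ : H_j → H_i`), `block_mem_centralizer_endAlg_of_mem_centralizer_endAlg_pi` (`c_j ∈ C(H_j)`),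
  **`piDiag_mem_centralizer_endAlg_pi_iff`** / `mem_centralizer_endAlg_pi_iff` (exact criterion); **"with equality holding if and
  only if `Hom(A_i, A_j) = 0`"**: `forall_piDiag_mem_centralizer_endAlg_pi_iff`; **Prop. 1.1**:
  `mem_centralizer_endAlg_pi_iff_of_hom_eq_zero` and the `ℚ`-ALGEBRA ISOMORPHISM **`centralizerPiAlgEquiv h0 : ∏_j C(H_j) ≃ₐ C(⊕_j H_j)`**.
* §2 **"identifies `C(A)` with `C(A^r)`"**: `mem_centralizer_endAlg_pi_const_iff` (`C(H₀^{⊕ι}) = Δ C(H₀)`, `ι ≠ ∅`),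
  **`centralizerPiConstAlgEquiv : C(H₀) ≃ₐ C(H₀^{⊕ι})`**.
* §3 **"the involution it defines on `C(A)` is the restriction of the product of the involutions"**: `Polarization.pi_form_single_single`, **`Polarization.adjoint_pi_piDiag`** (`diag(f)† = diag(f_j†)` for `⊕ Q_j`),
  `adjoint_pi_of_mem_centralizer_endAlg_pi`.
* §4 **Prop. 1.5 on `ℚ`-points**: `forall_pi_form_piCongrRight_iff`, **`piCongrRight_mem_lefschetzGroup_pi_iff`** (exact
  criterion), DEF `lefschetzGroupPiBlock` (the `j`-th block of `g ∈ S(⊕ H)(ℚ)`), **`eq_piCongrRight_lefschetzGroupPiBlock`**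
  (`g = Π_j g_j`), `lefschetzGroupPiBlock_mem_lefschetzGroup` (`g_j ∈ S(H_j)(ℚ)`), **`mem_lefschetzGroup_pi_iff_of_hom_eq_zero`**,
  `forall_piCongrRight_mem_lefschetzGroup_pi_iff` ("iff" for groups, testing `(1, …, -1, …, 1)`), and the GROUP ISOMORPHISM
  **`lefschetzGroupPiMulEquiv h0 : ∏_j S(H_j)(ℚ) ≃* S(⊕_j H_j)(ℚ)`**.
* §5 powers: **`mem_lefschetzGroup_pi_const_iff`** (`S(H₀^{⊕ι})(ℚ) = Δ S(H₀)(ℚ)`) and **`lefschetzGroupPiConstMulEquiv :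
  S(H₀)(ℚ) ≃* S(H₀^{⊕ι})(ℚ)`**.

NOT here: `K`-points `S(⊕ H)(K)` (the tree's `piBlockDiag` / `piDiagEmbedding` of `Motives/MumfordTateGroupDiagonal` give the
carrier; the binary case is g18-#5 `Motives/HodgeStructureLefschetzGroupDirectSumPoints`) — a sequel; mixed sums `⊕_i H_i^{⊕r_i}`
(compose §1/§4 with §2/§5); isogeny invariance (g20-#4 `Motives/HodgeStructureLefschetzGroupTransport`); Cor. 4.7 (the fibre
product of the `(L(A_i), l(A_i))`; binary case g19-#3). Related on OTHER carriers, BY NAME: `Milne1999/LefschetzCentraliserProducts`,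
`Milne1999/LefschetzGroupProducts`, `Milne1999/LefschetzCentraliserPowers` (the same statements on `H¹(A(ℂ); ℂ)` of complex abelian
varieties), `Geometry/Kaehler/ComplexTorusLefschetzGroupFiniteProduct` (`IsRiemannForm.lefschetzGroupPiMulEquiv`, complex tori with
Riemann forms), `Motives/HodgeGroupInvariantsSelfProducts` and `Motives/MumfordTateGroupDirectSumFamily` (the Mumford–Tate twins).

## References

* [Milne1999LefschetzClasses] J. S. Milne, *Lefschetz classes on abelian varieties*, Duke Math. J. 96 (1999) 639–675, §1 p. 643
  (the paragraphs "For any positive integer r" and "Let A = A₁ × ⋯ × A_s"), Proposition 1.1, p. 644 (`S(A)`), Proposition 1.5.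
* [DeligneHodgeII1971] P. Deligne, *Théorie de Hodge II*, Publ. Math. IHÉS 40 (1971), 2.1 (direct sums and morphisms of Hodge
  structures).
-/

noncomputable section

namespace Literature.AlgebraicGeometry.Motives

namespace HodgeStructure

universe u

variable {ι : Type} [Fintype ι] [DecidableEq ι] {W : ι → Type u} [∀ j, AddCommGroup (W j)] [∀ j, Module ℚ (W j)]
  {n : ℤ} (H : ∀ j, HodgeStructure (W j) n)

/-! ## §0 Block-diagonal endomorphisms `diag(f_j)` of `Π_j W_j` and the blocks of `End_HS(⊕_j H_j)` -/

section PiDiag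

omit H

/-- **The block-diagonal endomorphism `diag(f_j) : (x_j)_j ↦ (f_j x_j)_j` of `Π_j W_j`** (Milne's `α₁ ⊕ ⋯ ⊕ α_t`; the
`LinearMap` companion of Mathlib's `LinearEquiv.piCongrRight`). [cite: Milne1999LefschetzClasses, §1 p. 643 ("C(A) ⊂ C(A₁) × ⋯ × C(A_s)")] -/
def piDiag (f : ∀ j, Module.End ℚ (W j)) : Module.End ℚ (∀ j, W j) :=
  LinearMap.pi fun j ↦ f j ∘ₗ LinearMap.proj j

omit [Fintype ι] [DecidableEq ι] in
/-- `diag(f) x j = f_j (x j)`. [cite: Milne1999LefschetzClasses, §1 p. 643] -/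
@[simp] theorem piDiag_apply (f : ∀ j, Module.End ℚ (W j)) (x : ∀ j, W j) (j : ι) : piDiag f x j = f j (x j) :=
  rfl

omit [Fintype ι] in
/-- The `j`-th block of `diag(f)` is `f_j`: `pr_j ∘ diag(f) ∘ in_j = f_j`. [cite: Milne1999LefschetzClasses, §1 p. 643] -/
theorem proj_comp_piDiag_comp_single (f : ∀ j, Module.End ℚ (W j)) (j : ι) :
    LinearMap.proj j ∘ₗ piDiag f ∘ₗ LinearMap.single ℚ W j = f j := by
  refine LinearMap.ext fun v ↦ ?_
  simp

omit [Fintype ι] in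
/-- `diag(f) ∘ in_j = in_j ∘ f_j`. [cite: Milne1999LefschetzClasses, §1 p. 643] -/
theorem piDiag_comp_single (f : ∀ j, Module.End ℚ (W j)) (j : ι) :
    piDiag f ∘ₗ LinearMap.single ℚ W j = LinearMap.single ℚ W j ∘ₗ f j := by
  refine LinearMap.ext fun v ↦ funext fun i ↦ ?_
  by_cases hij : i = j
  · subst hij; simp
  · simp [Pi.single_eq_of_ne hij]

omit [Fintype ι] [DecidableEq ι] in
/-- `pr_j ∘ diag(f) = f_j ∘ pr_j`. [cite: Milne1999LefschetzClasses, §1 p. 643] -/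
theorem proj_comp_piDiag (f : ∀ j, Module.End ℚ (W j)) (j : ι) :
    LinearMap.proj j ∘ₗ piDiag f = f j ∘ₗ (LinearMap.proj j : (∀ i, W i) →ₗ[ℚ] W j) :=
  rfl

omit [Fintype ι] [DecidableEq ι] in
/-- `diag` is multiplicative. [cite: Milne1999LefschetzClasses, §1 p. 643] -/
theorem piDiag_mul (f g : ∀ j, Module.End ℚ (W j)) : piDiag (f * g) = piDiag f * piDiag g :=
  rfl

omit [Fintype ι] [DecidableEq ι] in
/-- `diag(1) = 1`. [cite: Milne1999LefschetzClasses, §1 p. 643] -/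
theorem piDiag_one : piDiag (1 : ∀ j, Module.End ℚ (W j)) = 1 :=
  rfl

omit [Fintype ι] in
/-- `diag` is injective. [cite: Milne1999LefschetzClasses, §1 p. 643] -/
theorem piDiag_injective : Function.Injective (piDiag (W := W)) := fun f g h ↦
  funext fun j ↦ by rw [← proj_comp_piDiag_comp_single f j, h, proj_comp_piDiag_comp_single]

/-- **`diag : Π_j End(W_j) →ₐ[ℚ] End(Π_j W_j)`** as an algebra homomorphism. [cite: Milne1999LefschetzClasses, §1 p. 643 and Prop. 1.1 ("isomorphism … of k-algebras")] -/
def piDiagAlgHom : (∀ j, Module.End ℚ (W j)) →ₐ[ℚ] Module.End ℚ (∀ j, W j) where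
  toFun := piDiag
  map_one' := rfl
  map_mul' _ _ := rfl
  map_zero' := rfl
  map_add' _ _ := rfl
  commutes' r := by
    refine LinearMap.ext fun x ↦ funext fun j ↦ ?_
    simp [piDiag, Algebra.algebraMap_eq_smul_one]

omit [Fintype ι] [DecidableEq ι] in
/-- `piDiagAlgHom f = diag(f)`. [cite: Milne1999LefschetzClasses, §1 p. 643] -/
@[simp] theorem piDiagAlgHom_apply (f : ∀ j, Module.End ℚ (W j)) : piDiagAlgHom f = piDiag f := rfl

omit [Fintype ι] [DecidableEq ι] in
/-- The underlying linear map of the block-diagonal automorphism `Π_j e_j` is `diag(e_j)`. [cite: Milne1999LefschetzClasses, §1 p. 644 (S(A))] -/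
theorem coe_piCongrRight_eq_piDiag (e : ∀ j, W j ≃ₗ[ℚ] W j) :
    (LinearEquiv.piCongrRight e : Module.End ℚ (∀ j, W j)) = piDiag fun j ↦ (e j : Module.End ℚ (W j)) :=
  rfl

/-- **Every endomorphism of `Π_j W_j` is the sum of its blocks**: `a = Σ_{i,j} in_i ∘ (pr_i a in_j) ∘ pr_j`. [folklore] -/
private theorem eq_sum_single_comp_block_comp_proj (a : Module.End ℚ (∀ j, W j)) :
    a = ∑ i, ∑ j, LinearMap.single ℚ W i ∘ₗ (LinearMap.proj i ∘ₗ a ∘ₗ LinearMap.single ℚ W j) ∘ₗ LinearMap.proj j := by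
  refine LinearMap.ext fun x ↦ funext fun k ↦ ?_
  simp only [LinearMap.coe_sum, Finset.sum_apply, LinearMap.coe_comp, Function.comp_apply, LinearMap.coe_proj,
    Function.eval, LinearMap.coe_single]
  rw [Finset.sum_eq_single k]
  · simp only [Pi.single_eq_same]
    conv_lhs => rw [← Finset.univ_sum_single x, map_sum, Finset.sum_apply]
  · intro i _ hik
    simp [Pi.single_eq_of_ne (Ne.symm hik)]
  · intro h; exact absurd (Finset.mem_univ k) h

end PiDiag

section EndAlgBlocks

/-- `in_i ∘ φ ∘ pr_j ∈ End_HS(⊕_k H_k)` for a morphism `φ : H_j → H_i` (a composite of morphisms of Hodge structures).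
[cite: DeligneHodgeII1971, 2.1] -/
theorem single_comp_hom_comp_proj_mem_endAlg_pi {i j : ι} (φ : Hom (H j) (H i)) :
    LinearMap.single ℚ W i ∘ₗ φ.toLinearMap ∘ₗ LinearMap.proj j ∈ (HodgeStructure.pi H).endAlg :=
  Hom.toLinearMap_mem_endAlg ((Hom.piSingle H i).comp (φ.comp (Hom.piProj H j)))

/-- The Hodge idempotent `in_j ∘ pr_j ∈ End_HS(⊕_k H_k)`. [cite: DeligneHodgeII1971, 2.1] -/
theorem single_comp_proj_mem_endAlg_pi (j : ι) :
    LinearMap.single ℚ W j ∘ₗ LinearMap.proj j ∈ (HodgeStructure.pi H).endAlg :=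
  Hom.toLinearMap_mem_endAlg ((Hom.piSingle H j).comp (Hom.piProj H j))

/-- `in_j ∘ a ∘ pr_j ∈ End_HS(⊕_k H_k)` for `a ∈ End_HS(H_j)`. [cite: DeligneHodgeII1971, 2.1] -/
theorem single_comp_comp_proj_mem_endAlg_pi {j : ι} {a : Module.End ℚ (W j)} (ha : a ∈ (H j).endAlg) :
    LinearMap.single ℚ W j ∘ₗ a ∘ₗ LinearMap.proj j ∈ (HodgeStructure.pi H).endAlg :=
  single_comp_hom_comp_proj_mem_endAlg_pi H (endAlg.toHom ⟨a, ha⟩)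

/-- **The `(i, j)`-block of a Hodge endomorphism of `⊕_k H_k` is a morphism `H_j → H_i`.** [cite: DeligneHodgeII1971, 2.1] -/
theorem exists_hom_toLinearMap_eq_block {a : Module.End ℚ (∀ j, W j)} (ha : a ∈ (HodgeStructure.pi H).endAlg) (i j : ι) :
    ∃ φ : Hom (H j) (H i), φ.toLinearMap = LinearMap.proj i ∘ₗ a ∘ₗ LinearMap.single ℚ W j :=
  ⟨(Hom.piProj H i).comp ((endAlg.toHom ⟨a, ha⟩).comp (Hom.piSingle H j)), rfl⟩

end EndAlgBlocks

/-! ## §1 Proposition 1.1 for a finite family: `C(⊕_j H_j) ⊆ ∏_j C(H_j)` (block diagonal), the intertwining relations,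
and EQUALITY iff `Hom(H_i, H_j) = 0` for `i ≠ j` -/

section Centralizer

variable {H}

/-- An element of `C(⊕_j H_j)` commutes with the Hodge idempotents `in_j pr_j` (pointwise). [cite: Milne1999LefschetzClasses, §1 p. 643] -/
theorem single_proj_apply_comm_of_mem_centralizer_endAlg_pi {c : Module.End ℚ (∀ j, W j)}
    (hc : c ∈ Subalgebra.centralizer ℚ ((HodgeStructure.pi H).endAlg : Set (Module.End ℚ (∀ j, W j)))) (j : ι) (x : ∀ j, W j) :
    LinearMap.single ℚ W j ((LinearMap.proj j : (∀ i, W i) →ₗ[ℚ] W j) (c x)) =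
      c (LinearMap.single ℚ W j ((LinearMap.proj j : (∀ i, W i) →ₗ[ℚ] W j) x)) := by
  have h := Subalgebra.mem_centralizer_iff ℚ |>.1 hc _ (single_comp_proj_mem_endAlg_pi H j)
  simpa only [Module.End.mul_apply, LinearMap.comp_apply] using LinearMap.congr_fun h x

/-- **Off-diagonal vanishing**: for `c ∈ C(⊕_j H_j)`, `(c (in_j v))_i = 0` when `i ≠ j`. [cite: Milne1999LefschetzClasses, §1 p. 643 ("C(A) ⊂ C(A₁) × ⋯ × C(A_s)")] -/
theorem apply_single_apply_of_ne_of_mem_centralizer_endAlg_pi {c : Module.End ℚ (∀ j, W j)}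
    (hc : c ∈ Subalgebra.centralizer ℚ ((HodgeStructure.pi H).endAlg : Set (Module.End ℚ (∀ j, W j)))) {i j : ι} (hij : i ≠ j)
    (v : W j) : c (Pi.single j v) i = 0 := by
  have h := congr_fun (single_proj_apply_comm_of_mem_centralizer_endAlg_pi hc j (Pi.single j v)) i
  simp only [LinearMap.coe_single, LinearMap.coe_proj, Function.eval, Pi.single_eq_same] at h
  rw [← h, Pi.single_eq_of_ne hij]

/-- **`c ∈ C(⊕_j H_j)` is block diagonal: `c = diag(pr_j c in_j)`.** [cite: Milne1999LefschetzClasses, §1 p. 643 ("C(A) ⊂ C(A₁) × ⋯ × C(A_s)")] -/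
theorem eq_piDiag_of_mem_centralizer_endAlg_pi {c : Module.End ℚ (∀ j, W j)}
    (hc : c ∈ Subalgebra.centralizer ℚ ((HodgeStructure.pi H).endAlg : Set (Module.End ℚ (∀ j, W j)))) :
    c = piDiag (W := W) fun j ↦ LinearMap.proj j ∘ₗ c ∘ₗ LinearMap.single ℚ W j := by
  refine LinearMap.ext fun x ↦ funext fun i ↦ ?_
  rw [piDiag_apply]
  simp only [LinearMap.coe_comp, Function.comp_apply, LinearMap.coe_proj, Function.eval, LinearMap.coe_single]
  conv_lhs => rw [← Finset.univ_sum_single x, map_sum, Finset.sum_apply]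
  rw [Finset.sum_eq_single i (fun j _ hji ↦ apply_single_apply_of_ne_of_mem_centralizer_endAlg_pi hc (Ne.symm hji) (x j))
    (fun h ↦ (h (Finset.mem_univ i)).elim)]

/-- **The intertwining relations**: for `c ∈ C(⊕_j H_j)` and a morphism `φ : H_j → H_i`, the blocks satisfy
`c_i ∘ φ = φ ∘ c_j`. [cite: Milne1999LefschetzClasses, §1 p. 643 ("with equality holding if and only if Hom(A_i, A_j) = 0")] -/
theorem block_comp_hom_eq_hom_comp_block_of_mem_centralizer_endAlg_pi {c : Module.End ℚ (∀ j, W j)}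
    (hc : c ∈ Subalgebra.centralizer ℚ ((HodgeStructure.pi H).endAlg : Set (Module.End ℚ (∀ j, W j)))) {i j : ι}
    (φ : Hom (H j) (H i)) :
    (LinearMap.proj i ∘ₗ c ∘ₗ LinearMap.single ℚ W i) ∘ₗ φ.toLinearMap =
      φ.toLinearMap ∘ₗ (LinearMap.proj j ∘ₗ c ∘ₗ LinearMap.single ℚ W j) := by
  have h := Subalgebra.mem_centralizer_iff ℚ |>.1 hc _ (single_comp_hom_comp_proj_mem_endAlg_pi H φ)
  refine LinearMap.ext fun v ↦ ?_
  have hv := congr_fun (LinearMap.congr_fun h (Pi.single j v)) i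
  simp only [Module.End.mul_apply, LinearMap.coe_comp, Function.comp_apply, LinearMap.coe_proj, Function.eval,
    LinearMap.coe_single, Pi.single_eq_same] at hv ⊢
  exact hv.symm

/-- **The `j`-th block of `c ∈ C(⊕_k H_k)` lies in `C(H_j)`** ("`C(A) ⊂ C(A₁) × ⋯ × C(A_s)`"). [cite: Milne1999LefschetzClasses, §1 p. 643] -/
theorem block_mem_centralizer_endAlg_of_mem_centralizer_endAlg_pi {c : Module.End ℚ (∀ j, W j)}
    (hc : c ∈ Subalgebra.centralizer ℚ ((HodgeStructure.pi H).endAlg : Set (Module.End ℚ (∀ j, W j)))) (j : ι) :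
    LinearMap.proj j ∘ₗ c ∘ₗ LinearMap.single ℚ W j ∈
      Subalgebra.centralizer ℚ ((H j).endAlg : Set (Module.End ℚ (W j))) := by
  rw [Subalgebra.mem_centralizer_iff]
  intro a ha
  exact (block_comp_hom_eq_hom_comp_block_of_mem_centralizer_endAlg_pi hc (endAlg.toHom ⟨a, ha⟩)).symm

variable (H) in
/-- **`diag(f) ∈ C(⊕_j H_j)` iff the `f_j` intertwine every morphism between the summands**: `f_i ∘ φ = φ ∘ f_j` for all
`φ : H_j → H_i` (all `i, j`; for `i = j`: `f_j ∈ C(H_j)`). [cite: Milne1999LefschetzClasses, §1 p. 643 ("C(A) ⊂ C(A₁) × ⋯ × C(A_s), with equality holding if and only if Hom(A_i, A_j) = 0 for all i ≠ j")] -/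
theorem piDiag_mem_centralizer_endAlg_pi_iff (f : ∀ j, Module.End ℚ (W j)) :
    piDiag f ∈ Subalgebra.centralizer ℚ ((HodgeStructure.pi H).endAlg : Set (Module.End ℚ (∀ j, W j))) ↔
      ∀ i j (φ : Hom (H j) (H i)), f i ∘ₗ φ.toLinearMap = φ.toLinearMap ∘ₗ f j := by
  constructor
  · intro hc i j φ
    have h := block_comp_hom_eq_hom_comp_block_of_mem_centralizer_endAlg_pi hc φ
    rwa [proj_comp_piDiag_comp_single, proj_comp_piDiag_comp_single] at h
  · intro hf
    rw [Subalgebra.mem_centralizer_iff]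
    intro a ha
    rw [eq_sum_single_comp_block_comp_proj a, Finset.sum_mul, Finset.mul_sum]
    refine Finset.sum_congr rfl fun i _ ↦ ?_
    rw [Finset.sum_mul, Finset.mul_sum]
    refine Finset.sum_congr rfl fun j _ ↦ ?_
    obtain ⟨φ, hφ⟩ := exists_hom_toLinearMap_eq_block H ha i j
    rw [← hφ]
    refine LinearMap.ext fun x ↦ funext fun k ↦ ?_
    have hk := LinearMap.congr_fun (hf i j φ) (x j)
    simp only [LinearMap.coe_comp, Function.comp_apply] at hk
    by_cases hki : k = i
    · subst hki
      simp [Module.End.mul_apply, hk]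
    · simp [Module.End.mul_apply, Pi.single_eq_of_ne hki]

variable (H) in
/-- **Proposition 1.1 for a finite family, membership form**: `c ∈ C(⊕_j H_j)` iff `c = diag(f)` with blocks intertwining all
morphisms between the summands. [cite: Milne1999LefschetzClasses, §1 p. 643 and Proposition 1.1] -/
theorem mem_centralizer_endAlg_pi_iff (c : Module.End ℚ (∀ j, W j)) :
    c ∈ Subalgebra.centralizer ℚ ((HodgeStructure.pi H).endAlg : Set (Module.End ℚ (∀ j, W j))) ↔
      ∃ f : ∀ j, Module.End ℚ (W j), c = piDiag f ∧
        ∀ i j (φ : Hom (H j) (H i)), f i ∘ₗ φ.toLinearMap = φ.toLinearMap ∘ₗ f j := by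
  constructor
  · intro hc
    refine ⟨_, eq_piDiag_of_mem_centralizer_endAlg_pi hc, ?_⟩
    rw [← piDiag_mem_centralizer_endAlg_pi_iff H, ← eq_piDiag_of_mem_centralizer_endAlg_pi hc]
    exact hc
  · rintro ⟨f, rfl, hf⟩
    exact (piDiag_mem_centralizer_endAlg_pi_iff H f).2 hf

variable (H) in
/-- **"with equality holding if and only if `Hom(A_i, A_j) = 0` for all `i ≠ j`"**: `diag(∏_j C(H_j)) ⊆ C(⊕_j H_j)` — i.e.
`C(⊕_j H_j) = ∏_j C(H_j)` — iff there are no non-zero morphisms between distinct summands ("⟹" tests the block-diagonal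
elements `diag(0, …, 1_i, …, 0)`). [cite: Milne1999LefschetzClasses, §1 p. 643 ("with equality holding if and only if Hom(A_i, A_j) = 0 for all i, j, i ≠ j")] -/
theorem forall_piDiag_mem_centralizer_endAlg_pi_iff :
    (∀ f : ∀ j, Module.End ℚ (W j),
        (∀ j, f j ∈ Subalgebra.centralizer ℚ ((H j).endAlg : Set (Module.End ℚ (W j)))) →
          piDiag f ∈ Subalgebra.centralizer ℚ ((HodgeStructure.pi H).endAlg : Set (Module.End ℚ (∀ j, W j)))) ↔
      ∀ i j, i ≠ j → ∀ φ : Hom (H j) (H i), φ.toLinearMap = 0 := by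
  constructor
  · intro h i j hij φ
    set f : ∀ k, Module.End ℚ (W k) := fun k ↦ if k = i then 1 else 0 with hf
    have hfC : ∀ k, f k ∈ Subalgebra.centralizer ℚ ((H k).endAlg : Set (Module.End ℚ (W k))) := by
      intro k
      by_cases hk : k = i
      · simp only [hf, hk, if_true]; exact Subalgebra.one_mem _
      · simp only [hf, hk, if_false]; exact Subalgebra.zero_mem _
    have key := (piDiag_mem_centralizer_endAlg_pi_iff H f).1 (h f hfC) i j φ
    refine LinearMap.ext fun v ↦ ?_
    have hv := LinearMap.congr_fun key v
    simpa [hf, if_neg (Ne.symm hij)] using hv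
  · intro h0 f hf
    refine (piDiag_mem_centralizer_endAlg_pi_iff H f).2 fun i j φ ↦ ?_
    by_cases hij : i = j
    · subst hij
      exact ((Subalgebra.mem_centralizer_iff ℚ).1 (hf i) _ (Hom.toLinearMap_mem_endAlg φ)).symm
    · rw [h0 i j hij φ, LinearMap.comp_zero, LinearMap.zero_comp]

variable (H) in
/-- **Proposition 1.1 for a finite family of pairwise `Hom`-orthogonal summands**: `c ∈ C(⊕_j H_j)` iff `c = diag(f_j)` with
`f_j ∈ C(H_j)` (Milne: `A_1, …, A_s` representatives of distinct simple isogeny classes). [cite: Milne1999LefschetzClasses, §1 Proposition 1.1] -/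
theorem mem_centralizer_endAlg_pi_iff_of_hom_eq_zero (h0 : ∀ i j, i ≠ j → ∀ φ : Hom (H j) (H i), φ.toLinearMap = 0)
    (c : Module.End ℚ (∀ j, W j)) :
    c ∈ Subalgebra.centralizer ℚ ((HodgeStructure.pi H).endAlg : Set (Module.End ℚ (∀ j, W j))) ↔
      ∃ f : ∀ j, Module.End ℚ (W j),
        (∀ j, f j ∈ Subalgebra.centralizer ℚ ((H j).endAlg : Set (Module.End ℚ (W j)))) ∧ c = piDiag f := by
  constructor
  · intro hc
    exact ⟨_, block_mem_centralizer_endAlg_of_mem_centralizer_endAlg_pi hc, eq_piDiag_of_mem_centralizer_endAlg_pi hc⟩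
  · rintro ⟨f, hf, rfl⟩
    exact (forall_piDiag_mem_centralizer_endAlg_pi_iff H).2 h0 f hf

variable (H) in
/-- **Proposition 1.1 as an isomorphism of `ℚ`-algebras `∏_j C(H_j) ≃ₐ C(⊕_j H_j)`, `(f_j) ↦ diag(f_j)`**, for pairwise
`Hom`-orthogonal summands ("Any such isogeny induces an isomorphism `C(A₁) × ⋯ × C(A_s) → C(A)` of `k`-algebras").
[cite: Milne1999LefschetzClasses, §1 Proposition 1.1] -/
def centralizerPiAlgEquiv (h0 : ∀ i j, i ≠ j → ∀ φ : Hom (H j) (H i), φ.toLinearMap = 0) :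
    (∀ j, Subalgebra.centralizer ℚ ((H j).endAlg : Set (Module.End ℚ (W j)))) ≃ₐ[ℚ]
      Subalgebra.centralizer ℚ ((HodgeStructure.pi H).endAlg : Set (Module.End ℚ (∀ j, W j))) :=
  AlgEquiv.ofBijective
    (((piDiagAlgHom (W := W)).comp
        (AlgHom.pi fun j ↦
          (Subalgebra.centralizer ℚ ((H j).endAlg : Set (Module.End ℚ (W j)))).val.comp
            (Pi.evalAlgHom ℚ _ j))).codRestrict
      (Subalgebra.centralizer ℚ ((HodgeStructure.pi H).endAlg : Set (Module.End ℚ (∀ j, W j)))) fun f ↦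
      (forall_piDiag_mem_centralizer_endAlg_pi_iff H).2 h0 (fun j ↦ (f j : Module.End ℚ (W j))) fun j ↦ (f j).2)
    ⟨fun f g hfg ↦ funext fun j ↦ Subtype.ext (congr_fun (piDiag_injective (congrArg Subtype.val hfg)) j),
      fun c ↦ by
        obtain ⟨f, hf, hc⟩ := (mem_centralizer_endAlg_pi_iff_of_hom_eq_zero H h0 c).1 c.2
        exact ⟨fun j ↦ ⟨f j, hf j⟩, Subtype.ext hc.symm⟩⟩

/-- `centralizerPiAlgEquiv (f_j) = diag(f_j)`. [cite: Milne1999LefschetzClasses, §1 Proposition 1.1] -/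
@[simp] theorem coe_centralizerPiAlgEquiv_apply (h0 : ∀ i j, i ≠ j → ∀ φ : Hom (H j) (H i), φ.toLinearMap = 0)
    (f : ∀ j, Subalgebra.centralizer ℚ ((H j).endAlg : Set (Module.End ℚ (W j)))) :
    (centralizerPiAlgEquiv H h0 f : Module.End ℚ (∀ j, W j)) = piDiag fun j ↦ (f j : Module.End ℚ (W j)) :=
  rfl

end Centralizer

/-! ## §2 Powers: "the diagonal action of `C(A)` on `rV(A)` identifies `C(A)` with `C(A^r)`" — `C(H^{⊕ι}) = Δ C(H)` -/

section Powers

variable {V : Type u} [AddCommGroup V] [Module ℚ V] (H₀ : HodgeStructure V n)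

/-- The identity of `H₀` as an element of `Hom(H₀, H₀)`. [folklore] -/
private theorem toLinearMap_toHom_one :
    (endAlg.toHom ⟨1, Subalgebra.one_mem H₀.endAlg⟩).toLinearMap = LinearMap.id :=
  rfl

/-- **`C(H^{⊕ι}) = Δ C(H)`**: for a non-empty finite index set, `c ∈ C(⊕_{j ∈ ι} H₀)` iff `c = diag(c₀, …, c₀)` with
`c₀ ∈ C(H₀)` (the intertwining with `id ∈ Hom(H₀, H₀)` forces all blocks to agree). [cite: Milne1999LefschetzClasses, §1 p. 643 ("V(A^r) = rV(A), and the diagonal action of C(A) on rV(A) identifies C(A) with C(A^r)")] -/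
theorem mem_centralizer_endAlg_pi_const_iff [Nonempty ι] (c : Module.End ℚ (ι → V)) :
    c ∈ Subalgebra.centralizer ℚ ((HodgeStructure.pi fun _ : ι ↦ H₀).endAlg : Set (Module.End ℚ (ι → V))) ↔
      ∃ c₀ ∈ Subalgebra.centralizer ℚ (H₀.endAlg : Set (Module.End ℚ V)), c = piDiag fun _ : ι ↦ c₀ := by
  obtain ⟨i₀⟩ := ‹Nonempty ι›
  rw [mem_centralizer_endAlg_pi_iff]
  constructor
  · rintro ⟨f, rfl, hf⟩
    have heq : ∀ j, f j = f i₀ := fun j ↦ by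
      have h := hf j i₀ (endAlg.toHom ⟨1, Subalgebra.one_mem H₀.endAlg⟩)
      rwa [toLinearMap_toHom_one, LinearMap.comp_id, LinearMap.id_comp] at h
    refine ⟨f i₀, ?_, congrArg piDiag (funext heq)⟩
    rw [Subalgebra.mem_centralizer_iff]
    intro a ha
    exact (hf i₀ i₀ (endAlg.toHom ⟨a, ha⟩)).symm
  · rintro ⟨c₀, hc₀, rfl⟩
    refine ⟨fun _ ↦ c₀, rfl, fun i j φ ↦ ?_⟩
    exact ((Subalgebra.mem_centralizer_iff ℚ).1 hc₀ _ (Hom.toLinearMap_mem_endAlg φ)).symm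

omit [Fintype ι] [DecidableEq ι] in
/-- The diagonal `c₀ ↦ diag(c₀, …, c₀)` is injective for `ι` non-empty. [cite: Milne1999LefschetzClasses, §1 p. 643] -/
theorem piDiag_const_injective [Nonempty ι] :
    Function.Injective fun c₀ : Module.End ℚ V ↦ piDiag (fun _ : ι ↦ c₀) := by
  obtain ⟨i₀⟩ := ‹Nonempty ι›
  intro c c' h
  refine LinearMap.ext fun v ↦ ?_
  have := congr_fun (LinearMap.congr_fun h (fun _ ↦ v)) i₀
  simpa using this

/-- **`C(H₀) ≃ₐ C(H₀^{⊕ι})`, `c₀ ↦ diag(c₀, …, c₀)`** ("identifies `C(A)` with `C(A^r)` (as `k`-algebras with involution)").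
[cite: Milne1999LefschetzClasses, §1 p. 643 ("the diagonal action of C(A) on rV(A) identifies C(A) with C(A^r)")] -/
def centralizerPiConstAlgEquiv [Nonempty ι] :
    Subalgebra.centralizer ℚ (H₀.endAlg : Set (Module.End ℚ V)) ≃ₐ[ℚ]
      Subalgebra.centralizer ℚ ((HodgeStructure.pi fun _ : ι ↦ H₀).endAlg : Set (Module.End ℚ (ι → V))) :=
  AlgEquiv.ofBijective
    (((piDiagAlgHom (W := fun _ : ι ↦ V)).comp
        (AlgHom.pi fun _ : ι ↦ (Subalgebra.centralizer ℚ (H₀.endAlg : Set (Module.End ℚ V))).val)).codRestrict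
      (Subalgebra.centralizer ℚ ((HodgeStructure.pi fun _ : ι ↦ H₀).endAlg : Set (Module.End ℚ (ι → V)))) fun c ↦
      (mem_centralizer_endAlg_pi_const_iff H₀ _).2 ⟨c, c.2, rfl⟩)
    ⟨fun c c' h ↦ Subtype.ext (piDiag_const_injective (congrArg Subtype.val h)),
      fun c ↦ by
        obtain ⟨c₀, hc₀, hc⟩ := (mem_centralizer_endAlg_pi_const_iff H₀ (c : Module.End ℚ (ι → V))).1 c.2
        exact ⟨⟨c₀, hc₀⟩, Subtype.ext hc.symm⟩⟩

/-- `centralizerPiConstAlgEquiv c₀ = diag(c₀, …, c₀)`. [cite: Milne1999LefschetzClasses, §1 p. 643] -/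
@[simp] theorem coe_centralizerPiConstAlgEquiv_apply [Nonempty ι]
    (c : Subalgebra.centralizer ℚ (H₀.endAlg : Set (Module.End ℚ V))) :
    (centralizerPiConstAlgEquiv (ι := ι) H₀ c : Module.End ℚ (ι → V)) = piDiag fun _ : ι ↦ (c : Module.End ℚ V) :=
  rfl

end Powers

/-! ## §3 The involution: the product polarization's adjoint is the product of the adjoints
("isomorphism … of `k`-algebras with involution") -/

section Involution

variable {H} (Q : ∀ j, Polarization (H j))

/-- `(⊕ Q_j)((x_j), (y_j)) = Σ_j Q_j(x_j, y_j)` (private copy of the tree's `Polarization.pi_form_apply` of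
`Geometry/Kaehler/ComplexTorusHodgeStructurePolarization` / `Polarization.pi_form_apply'` of
`Motives/HodgeStructureCMOrthogonalDecomposition`, neither importable here without CM / torus baggage). [folklore] -/
private theorem Polarization.pi_form_eq_sum_blocks (x y : ∀ j, W j) :
    (Polarization.pi Q).form x y = ∑ j, (Q j).form (x j) (y j) := by
  simp [Polarization.pi, LinearMap.sum_apply, LinearMap.compl₁₂_apply]

/-- `(⊕ Q_j)` on vectors supported at `j`: `(⊕ Q)(in_j a, in_j b) = Q_j(a, b)`. [cite: Milne1999LefschetzClasses, §1 p. 643] -/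
theorem Polarization.pi_form_single_single (j : ι) (a b : W j) :
    (Polarization.pi Q).form (Pi.single j a) (Pi.single j b) = (Q j).form a b := by
  rw [Polarization.pi_form_eq_sum_blocks, Finset.sum_eq_single j]
  · rw [Pi.single_eq_same, Pi.single_eq_same]
  · intro k _ hkj
    rw [Pi.single_eq_of_ne hkj, map_zero, LinearMap.zero_apply]
  · intro h; exact absurd (Finset.mem_univ j) h

variable [∀ j, Module.Finite ℚ (W j)]

/-- **The involution of `⊕_j Q_j` on block-diagonal elements is the product of the involutions**:
`diag(f_j)† = diag(f_j†)` ("the involution it defines on `C(A)` is the restriction of the product of the involutions on the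
`C(A_i)` defined by the `D_i`"). [cite: Milne1999LefschetzClasses, §1 p. 643 (the paragraph "Let A = A₁ × ⋯ × A_s") and Proposition 1.1 ("of k-algebras with involution")] -/
theorem Polarization.adjoint_pi_piDiag (f : ∀ j, Module.End ℚ (W j)) :
    (Polarization.pi Q).adjoint (piDiag f) = piDiag fun j ↦ (Q j).adjoint (f j) := by
  refine ((Polarization.pi Q).eq_adjoint_of_isAdjointPair fun x y ↦ ?_).symm
  rw [Polarization.pi_form_eq_sum_blocks, Polarization.pi_form_eq_sum_blocks]
  refine Finset.sum_congr rfl fun j _ ↦ ?_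
  rw [piDiag_apply, piDiag_apply, (Q j).form_apply_adjoint]

/-- On `C(⊕_j H_j) ⊆ ∏_j C(H_j)` the involution is the product of the involutions: `(c†)_j = (c_j)†`.
[cite: Milne1999LefschetzClasses, §1 Proposition 1.1 ("of k-algebras with involution")] -/
theorem Polarization.adjoint_pi_of_mem_centralizer_endAlg_pi {c : Module.End ℚ (∀ j, W j)}
    (hc : c ∈ Subalgebra.centralizer ℚ ((HodgeStructure.pi H).endAlg : Set (Module.End ℚ (∀ j, W j)))) :
    (Polarization.pi Q).adjoint c =
      piDiag fun j ↦ (Q j).adjoint (LinearMap.proj j ∘ₗ c ∘ₗ LinearMap.single ℚ W j) := by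
  conv_lhs => rw [eq_piDiag_of_mem_centralizer_endAlg_pi hc]
  exact Polarization.adjoint_pi_piDiag Q _

end Involution

/-! ## §4 Proposition 1.5 for a finite family on `ℚ`-points: `S(⊕_j H_j)(ℚ) ⊆ ∏_j S(H_j)(ℚ)`, with equality iff the summands
are pairwise `Hom`-orthogonal -/

section LefschetzGroup

variable {H} (Q : ∀ j, Polarization (H j))

omit [Fintype ι] in
/-- `(Π_j e_j)(in_j v) = in_j (e_j v)`. [folklore] -/
private theorem piCongrRight_single (e : ∀ j, W j ≃ₗ[ℚ] W j) (j : ι) (v : W j) :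
    LinearEquiv.piCongrRight e (Pi.single j v) = Pi.single j (e j v) := by
  funext k
  rw [LinearEquiv.piCongrRight_apply]
  by_cases hkj : k = j
  · subst hkj; rw [Pi.single_eq_same, Pi.single_eq_same]
  · rw [Pi.single_eq_of_ne hkj, Pi.single_eq_of_ne hkj, map_zero]

/-- **`Π_j e_j` preserves `⊕_j Q_j` iff each `e_j` preserves `Q_j`.** [cite: Milne1999LefschetzClasses, §1 p. 644 (S(A)) and Proposition 1.5] -/
theorem Polarization.forall_pi_form_piCongrRight_iff (e : ∀ j, W j ≃ₗ[ℚ] W j) :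
    (∀ x y, (Polarization.pi Q).form (LinearEquiv.piCongrRight e x) (LinearEquiv.piCongrRight e y) =
        (Polarization.pi Q).form x y) ↔
      ∀ j, ∀ v w, (Q j).form (e j v) (e j w) = (Q j).form v w := by
  constructor
  · intro h j v w
    have h' := h (Pi.single j v) (Pi.single j w)
    rwa [piCongrRight_single, piCongrRight_single, Polarization.pi_form_single_single,
      Polarization.pi_form_single_single] at h'
  · intro h x y
    rw [Polarization.pi_form_eq_sum_blocks, Polarization.pi_form_eq_sum_blocks]
    exact Finset.sum_congr rfl fun j _ ↦ by rw [LinearEquiv.piCongrRight_apply, LinearEquiv.piCongrRight_apply, h j]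

/-- **`Π_j e_j ∈ S(⊕_j H_j)(ℚ)` exactly when** the `e_j` intertwine all morphisms between the summands (in particular
`e_j ∈ C(H_j)`) **and each `e_j` preserves `Q_j`.** [cite: Milne1999LefschetzClasses, §1 Proposition 1.5 and p. 643] -/
theorem Polarization.piCongrRight_mem_lefschetzGroup_pi_iff (e : ∀ j, W j ≃ₗ[ℚ] W j) :
    LinearEquiv.piCongrRight e ∈ (Polarization.pi Q).lefschetzGroup ↔
      (∀ i j (φ : Hom (H j) (H i)),
          (e i : Module.End ℚ (W i)) ∘ₗ φ.toLinearMap = φ.toLinearMap ∘ₗ (e j : Module.End ℚ (W j))) ∧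
        ∀ j, ∀ v w, (Q j).form (e j v) (e j w) = (Q j).form v w := by
  rw [Polarization.mem_lefschetzGroup_iff, forall_endAlg_apply_iff_coe_mem_centralizer_endAlg,
    coe_piCongrRight_eq_piDiag, piDiag_mem_centralizer_endAlg_pi_iff, Polarization.forall_pi_form_piCongrRight_iff]

/-- `g ∈ S(⊕_j H_j)(ℚ)` commutes with the Hodge idempotent `in_j pr_j` (pointwise). [cite: Milne1999LefschetzClasses, §1 p. 644] -/
theorem Polarization.single_proj_apply_comm_of_mem_lefschetzGroup_pi {g : (∀ j, W j) ≃ₗ[ℚ] (∀ j, W j)}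
    (hg : g ∈ (Polarization.pi Q).lefschetzGroup) (j : ι) (x : ∀ j, W j) :
    LinearMap.single ℚ W j ((LinearMap.proj j : (∀ i, W i) →ₗ[ℚ] W j) (g x)) =
      g (LinearMap.single ℚ W j ((LinearMap.proj j : (∀ i, W i) →ₗ[ℚ] W j) x)) :=
  hg.1 ⟨_, single_comp_proj_mem_endAlg_pi H j⟩ x

/-- **The `j`-th block `pr_j g in_j ∈ GL(W_j)` of `g ∈ S(⊕_k H_k)(ℚ)`** (the tree's `restrictRetract` of the retract
`(in_j, pr_j)`). [cite: Milne1999LefschetzClasses, §1 p. 644 and Proposition 1.5] -/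
def Polarization.lefschetzGroupPiBlock {g : (∀ j, W j) ≃ₗ[ℚ] (∀ j, W j)}
    (hg : g ∈ (Polarization.pi Q).lefschetzGroup) (j : ι) : W j ≃ₗ[ℚ] W j :=
  restrictRetract (LinearMap.single ℚ W j) (LinearMap.proj j) (fun v ↦ by simp) g
    (Polarization.single_proj_apply_comm_of_mem_lefschetzGroup_pi Q hg j)

/-- `(block_j g) v = (g (in_j v))_j`. [cite: Milne1999LefschetzClasses, §1 p. 644] -/
@[simp] theorem Polarization.lefschetzGroupPiBlock_apply {g : (∀ j, W j) ≃ₗ[ℚ] (∀ j, W j)}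
    (hg : g ∈ (Polarization.pi Q).lefschetzGroup) (j : ι) (v : W j) :
    Polarization.lefschetzGroupPiBlock Q hg j v = g (Pi.single j v) j :=
  rfl

/-- The block of `g ∈ S(⊕ H)(ℚ)` as an endomorphism is `pr_j ∘ g ∘ in_j`. [cite: Milne1999LefschetzClasses, §1 p. 644] -/
theorem Polarization.coe_lefschetzGroupPiBlock {g : (∀ j, W j) ≃ₗ[ℚ] (∀ j, W j)}
    (hg : g ∈ (Polarization.pi Q).lefschetzGroup) (j : ι) :
    (Polarization.lefschetzGroupPiBlock Q hg j : Module.End ℚ (W j)) =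
      LinearMap.proj j ∘ₗ (g : Module.End ℚ (∀ j, W j)) ∘ₗ LinearMap.single ℚ W j :=
  rfl

/-- **Every `g ∈ S(⊕_j H_j)(ℚ)` is block diagonal: `g = Π_j (block_j g)`** ("`S(A) ⊂ S(A₁) × ⋯ × S(A_s)`").
[cite: Milne1999LefschetzClasses, §1 Proposition 1.5] -/
theorem Polarization.eq_piCongrRight_lefschetzGroupPiBlock {g : (∀ j, W j) ≃ₗ[ℚ] (∀ j, W j)}
    (hg : g ∈ (Polarization.pi Q).lefschetzGroup) :
    g = LinearEquiv.piCongrRight (Polarization.lefschetzGroupPiBlock Q hg) := by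
  have hC := (forall_endAlg_apply_iff_coe_mem_centralizer_endAlg (HodgeStructure.pi H) g).1 hg.1
  refine LinearEquiv.toLinearMap_injective ?_
  rw [coe_piCongrRight_eq_piDiag]
  exact eq_piDiag_of_mem_centralizer_endAlg_pi hC

/-- **The blocks of `g ∈ S(⊕_j H_j)(ℚ)` lie in `S(H_j)(ℚ)`.** [cite: Milne1999LefschetzClasses, §1 Proposition 1.5] -/
theorem Polarization.lefschetzGroupPiBlock_mem_lefschetzGroup {g : (∀ j, W j) ≃ₗ[ℚ] (∀ j, W j)}
    (hg : g ∈ (Polarization.pi Q).lefschetzGroup) (j : ι) :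
    Polarization.lefschetzGroupPiBlock Q hg j ∈ (Q j).lefschetzGroup := by
  have h := (Polarization.piCongrRight_mem_lefschetzGroup_pi_iff Q (Polarization.lefschetzGroupPiBlock Q hg)).1
    (by rw [← Polarization.eq_piCongrRight_lefschetzGroupPiBlock Q hg]; exact hg)
  refine ⟨fun a v ↦ ?_, h.2 j⟩
  have ha := LinearMap.congr_fun (h.1 j j (endAlg.toHom a)) v
  simp only [LinearMap.coe_comp, Function.comp_apply, LinearEquiv.coe_coe, endAlg.toHom_toLinearMap] at ha
  exact ha.symm

/-- **Proposition 1.5, membership form**: for pairwise `Hom`-orthogonal summands, `g ∈ S(⊕_j H_j)(ℚ)` iff `g = Π_j e_j` with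
`e_j ∈ S(H_j)(ℚ)`. [cite: Milne1999LefschetzClasses, §1 Proposition 1.5 ("S(A₁) × ⋯ × S(A_s) → S(A) … is an isomorphism")] -/
theorem Polarization.mem_lefschetzGroup_pi_iff_of_hom_eq_zero
    (h0 : ∀ i j, i ≠ j → ∀ φ : Hom (H j) (H i), φ.toLinearMap = 0) (g : (∀ j, W j) ≃ₗ[ℚ] (∀ j, W j)) :
    g ∈ (Polarization.pi Q).lefschetzGroup ↔
      ∃ e : ∀ j, W j ≃ₗ[ℚ] W j, (∀ j, e j ∈ (Q j).lefschetzGroup) ∧ g = LinearEquiv.piCongrRight e := by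
  constructor
  · intro hg
    exact ⟨_, Polarization.lefschetzGroupPiBlock_mem_lefschetzGroup Q hg, Polarization.eq_piCongrRight_lefschetzGroupPiBlock Q hg⟩
  · rintro ⟨e, he, rfl⟩
    refine (Polarization.piCongrRight_mem_lefschetzGroup_pi_iff Q e).2 ⟨fun i j φ ↦ ?_, fun j ↦ (he j).2⟩
    by_cases hij : i = j
    · subst hij
      have hC := (forall_endAlg_apply_iff_coe_mem_centralizer_endAlg (H i) (e i)).1 (he i).1
      exact ((Subalgebra.mem_centralizer_iff ℚ).1 hC _ (Hom.toLinearMap_mem_endAlg φ)).symm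
    · rw [h0 i j hij φ, LinearMap.comp_zero, LinearMap.zero_comp]

omit Q in
/-- `-id ∈ S(H)(ℚ)` (Mathlib's `LinearEquiv.neg ℚ`). [cite: Milne1999LefschetzClasses, §1 p. 644 (S(A))] -/
private theorem neg_mem_lefschetzGroup' {V : Type u} [AddCommGroup V] [Module ℚ V] {H₀ : HodgeStructure V n}
    (Q₀ : Polarization H₀) : LinearEquiv.neg ℚ ∈ Q₀.lefschetzGroup := by
  refine ⟨fun a v ↦ ?_, fun v w ↦ ?_⟩
  · rw [LinearEquiv.neg_apply, LinearEquiv.neg_apply, map_neg]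
  · rw [LinearEquiv.neg_apply, LinearEquiv.neg_apply, map_neg, map_neg, LinearMap.neg_apply, neg_neg]

/-- **Proposition 1.5: `(e_j) ↦ Π_j e_j` maps `∏_j S(H_j)(ℚ)` into (hence onto) `S(⊕_j H_j)(ℚ)` iff the summands are pairwise
`Hom`-orthogonal** (Milne: the `A_i` pairwise non-isogenous simple; "⟹" tests `(1, …, -1_j, …, 1)`, which intertwines
`φ : H_j → H_i` only if `φ = -φ`). [cite: Milne1999LefschetzClasses, §1 Proposition 1.5] -/
theorem Polarization.forall_piCongrRight_mem_lefschetzGroup_pi_iff :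
    (∀ e : ∀ j, W j ≃ₗ[ℚ] W j, (∀ j, e j ∈ (Q j).lefschetzGroup) →
        LinearEquiv.piCongrRight e ∈ (Polarization.pi Q).lefschetzGroup) ↔
      ∀ i j, i ≠ j → ∀ φ : Hom (H j) (H i), φ.toLinearMap = 0 := by
  constructor
  · intro h i j hij φ
    set e : ∀ k, W k ≃ₗ[ℚ] W k := fun k ↦ if k = j then LinearEquiv.neg ℚ else 1 with he
    have heS : ∀ k, e k ∈ (Q k).lefschetzGroup := fun k ↦ by
      by_cases hk : k = j
      · simp only [he, hk, if_true]; exact neg_mem_lefschetzGroup' (Q k)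
      · simp only [he, hk, if_false]; exact Subgroup.one_mem _
    have key := ((Polarization.piCongrRight_mem_lefschetzGroup_pi_iff Q e).1 (h e heS)).1 i j φ
    refine LinearMap.ext fun v ↦ ?_
    have hv := LinearMap.congr_fun key v
    simp only [he, if_neg hij, if_true, LinearMap.coe_comp, Function.comp_apply, LinearEquiv.coe_coe,
      LinearEquiv.coe_one, id_eq, LinearEquiv.neg_apply, map_neg] at hv
    -- `φ v = -φ v`
    have h2 : (2 : ℚ) • φ.toLinearMap v = 0 := by rw [two_smul]; nth_rw 1 [hv]; exact neg_add_cancel _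
    rw [LinearMap.zero_apply]
    exact (smul_eq_zero.1 h2).resolve_left two_ne_zero
  · intro h0 e he
    exact (Polarization.mem_lefschetzGroup_pi_iff_of_hom_eq_zero Q h0 _).2 ⟨e, he, rfl⟩

omit [Fintype ι] in
/-- The blocks of `Π_j e_j` are the `e_j`. [folklore] -/
private theorem proj_piCongrRight_single (e : ∀ j, W j ≃ₗ[ℚ] W j) (j : ι) (v : W j) :
    LinearEquiv.piCongrRight e (Pi.single j v) j = e j v := by
  rw [LinearEquiv.piCongrRight_apply, Pi.single_eq_same]

/-- **Proposition 1.5 as an isomorphism of groups `∏_j S(H_j)(ℚ) ≃* S(⊕_j H_j)(ℚ)`, `(e_j) ↦ Π_j e_j`**, for pairwise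
`Hom`-orthogonal summands ("Any such isogeny induces an isomorphism `S(A₁) × ⋯ × S(A_s) → S(A)`").
[cite: Milne1999LefschetzClasses, §1 Proposition 1.5] -/
def Polarization.lefschetzGroupPiMulEquiv (h0 : ∀ i j, i ≠ j → ∀ φ : Hom (H j) (H i), φ.toLinearMap = 0) :
    (∀ j, (Q j).lefschetzGroup) ≃* (Polarization.pi Q).lefschetzGroup where
  toFun e := ⟨LinearEquiv.piCongrRight fun j ↦ (e j : W j ≃ₗ[ℚ] W j),
    (Polarization.mem_lefschetzGroup_pi_iff_of_hom_eq_zero Q h0 _).2 ⟨_, fun j ↦ (e j).2, rfl⟩⟩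
  invFun g := fun j ↦ ⟨Polarization.lefschetzGroupPiBlock Q g.2 j, Polarization.lefschetzGroupPiBlock_mem_lefschetzGroup Q g.2 j⟩
  left_inv e := funext fun j ↦ Subtype.ext (LinearEquiv.ext fun v ↦ by
    rw [Polarization.lefschetzGroupPiBlock_apply]
    exact proj_piCongrRight_single _ j v)
  right_inv g := Subtype.ext (Polarization.eq_piCongrRight_lefschetzGroupPiBlock Q g.2).symm
  map_mul' e e' := Subtype.ext (LinearEquiv.ext fun x ↦ rfl)

/-- `lefschetzGroupPiMulEquiv (e_j) = Π_j e_j`. [cite: Milne1999LefschetzClasses, §1 Proposition 1.5] -/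
@[simp] theorem Polarization.coe_lefschetzGroupPiMulEquiv_apply
    (h0 : ∀ i j, i ≠ j → ∀ φ : Hom (H j) (H i), φ.toLinearMap = 0) (e : ∀ j, (Q j).lefschetzGroup) :
    ((Polarization.lefschetzGroupPiMulEquiv Q h0 e : (Polarization.pi Q).lefschetzGroup) : (∀ j, W j) ≃ₗ[ℚ] (∀ j, W j)) =
      LinearEquiv.piCongrRight fun j ↦ (e j : W j ≃ₗ[ℚ] W j) :=
  rfl

end LefschetzGroup

/-! ## §5 Powers for `S`: `S(H^{⊕ι})(ℚ) = Δ S(H)(ℚ)` ("`S(A)` … depends only on `A` up to isogeny; `S(A^r) = S(A)`") -/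

section LefschetzGroupPowers

variable {V : Type u} [AddCommGroup V] [Module ℚ V] {H₀ : HodgeStructure V n} (Q₀ : Polarization H₀)

/-- **`S(H₀^{⊕ι})(ℚ) = Δ S(H₀)(ℚ)`**: for `ι` non-empty, `g ∈ S(⊕_{j∈ι} H₀)(ℚ)` (for the product polarization) iff
`g = Π_j g₀` is the diagonal image of some `g₀ ∈ S(H₀)(ℚ)`. [cite: Milne1999LefschetzClasses, §1 p. 644 ("S(A) depends only on the isogeny class of A") and p. 643 ("identifies C(A) with C(A^r)")] -/
theorem Polarization.mem_lefschetzGroup_pi_const_iff [Nonempty ι] (g : (ι → V) ≃ₗ[ℚ] (ι → V)) :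
    g ∈ (Polarization.pi fun _ : ι ↦ Q₀).lefschetzGroup ↔
      ∃ g₀ ∈ Q₀.lefschetzGroup, g = LinearEquiv.piCongrRight fun _ : ι ↦ g₀ := by
  obtain ⟨i₀⟩ := ‹Nonempty ι›
  constructor
  · intro hg
    set e := Polarization.lefschetzGroupPiBlock (fun _ : ι ↦ Q₀) hg with he
    have hmem := (Polarization.piCongrRight_mem_lefschetzGroup_pi_iff (fun _ : ι ↦ Q₀) e).1
      (by rw [← Polarization.eq_piCongrRight_lefschetzGroupPiBlock (fun _ : ι ↦ Q₀) hg]; exact hg)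
    have heq : ∀ j, e j = e i₀ := fun j ↦ by
      refine LinearEquiv.toLinearMap_injective ?_
      have h := hmem.1 j i₀ (endAlg.toHom ⟨1, Subalgebra.one_mem H₀.endAlg⟩)
      rwa [toLinearMap_toHom_one, LinearMap.comp_id, LinearMap.id_comp] at h
    refine ⟨e i₀, Polarization.lefschetzGroupPiBlock_mem_lefschetzGroup (fun _ : ι ↦ Q₀) hg i₀, ?_⟩
    rw [Polarization.eq_piCongrRight_lefschetzGroupPiBlock (fun _ : ι ↦ Q₀) hg]
    exact congrArg LinearEquiv.piCongrRight (funext heq)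
  · rintro ⟨g₀, hg₀, rfl⟩
    refine (Polarization.piCongrRight_mem_lefschetzGroup_pi_iff (fun _ : ι ↦ Q₀) _).2 ⟨fun i j φ ↦ ?_, fun _ ↦ hg₀.2⟩
    have hC := (forall_endAlg_apply_iff_coe_mem_centralizer_endAlg H₀ g₀).1 hg₀.1
    exact ((Subalgebra.mem_centralizer_iff ℚ).1 hC _ (Hom.toLinearMap_mem_endAlg φ)).symm

omit [Fintype ι] [DecidableEq ι] in
/-- The diagonal `g₀ ↦ Π_j g₀` is injective for `ι` non-empty. [folklore] -/
private theorem piCongrRight_const_injective [Nonempty ι] :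
    Function.Injective fun g₀ : V ≃ₗ[ℚ] V ↦ LinearEquiv.piCongrRight fun _ : ι ↦ g₀ := by
  obtain ⟨i₀⟩ := ‹Nonempty ι›
  intro g g' h
  refine LinearEquiv.ext fun v ↦ ?_
  have := congr_fun (LinearEquiv.congr_fun h (fun _ ↦ v)) i₀
  simpa using this

/-- **`S(H₀)(ℚ) ≃* S(H₀^{⊕ι})(ℚ)`, `g₀ ↦ Π_j g₀` (the diagonal)**, for `ι` non-empty. [cite: Milne1999LefschetzClasses, §1 p. 644 ("S(A) depends only on the isogeny class of A") and Proposition 1.5] -/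
def Polarization.lefschetzGroupPiConstMulEquiv [Nonempty ι] :
    Q₀.lefschetzGroup ≃* (Polarization.pi fun _ : ι ↦ Q₀).lefschetzGroup where
  toFun g := ⟨LinearEquiv.piCongrRight fun _ : ι ↦ (g : V ≃ₗ[ℚ] V),
    (Polarization.mem_lefschetzGroup_pi_const_iff Q₀ _).2 ⟨_, g.2, rfl⟩⟩
  invFun g := ⟨(Polarization.mem_lefschetzGroup_pi_const_iff Q₀ (g : (ι → V) ≃ₗ[ℚ] (ι → V))).1 g.2 |>.choose,
    ((Polarization.mem_lefschetzGroup_pi_const_iff Q₀ (g : (ι → V) ≃ₗ[ℚ] (ι → V))).1 g.2 |>.choose_spec).1⟩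
  left_inv g := by
    refine Subtype.ext (piCongrRight_const_injective (ι := ι) ?_)
    exact (((Polarization.mem_lefschetzGroup_pi_const_iff Q₀ _).1
      ((Polarization.mem_lefschetzGroup_pi_const_iff Q₀ _).2 ⟨_, g.2, rfl⟩)).choose_spec.2).symm
  right_inv g := Subtype.ext
    (((Polarization.mem_lefschetzGroup_pi_const_iff Q₀ (g : (ι → V) ≃ₗ[ℚ] (ι → V))).1 g.2).choose_spec.2).symm
  map_mul' g g' := Subtype.ext (LinearEquiv.ext fun x ↦ rfl)

/-- `lefschetzGroupPiConstMulEquiv g₀ = Π_j g₀`. [cite: Milne1999LefschetzClasses, §1 Proposition 1.5] -/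
@[simp] theorem Polarization.coe_lefschetzGroupPiConstMulEquiv_apply [Nonempty ι] (g : Q₀.lefschetzGroup) :
    ((Polarization.lefschetzGroupPiConstMulEquiv (ι := ι) Q₀ g : (Polarization.pi fun _ : ι ↦ Q₀).lefschetzGroup) :
        (ι → V) ≃ₗ[ℚ] (ι → V)) = LinearEquiv.piCongrRight fun _ : ι ↦ (g : V ≃ₗ[ℚ] V) :=
  rfl

end LefschetzGroupPowers


end HodgeStructure

end Literature.AlgebraicGeometry.Motives
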